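import Mathlib
import Literature.AlgebraicGeometry.Resolution.CechH1DominationPointwise
import Literature.AlgebraicGeometry.Morphisms.CechH1Refinement
import Literature.AlgebraicGeometry.Morphisms.CechH1LengthComparison
import Literature.AlgebraicGeometry.Morphisms.SeparatedAffinePreimage
import HarnessLib

/-!
# Leray in degree one along a proper birational morphism of regular surfaces, POINTWISE form — part 2:
# the gluing `Ȟ¹(Y₁, 𝒪) = 0 ⇒ Ȟ¹(X, 𝒪) = 0` for every finite affine cover

Topic: `Literature/AlgebraicGeometry/Resolution`.  Row F79-L of the F-79 «2-reg» sub-cell of the D-0154 (2) RES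
inputs cell at universe `u` (OPTION Ⅱ; planner skeleton `F79_2reg_BRICKS_SKELETON.lean`, `stub_leray`, statement
BYTE-VERBATIM as `hasTrivialCechH1_comp_of_isBirational_of_forall_stalk`); sequel of
`Resolution/CechH1DominationPointwise.lean` ((L1) pointwise vanishing, (L2) chartwise vanishing, (L3) the
surjection `Ȟ¹(𝒰, 𝒪_X) ↠ Ȟ¹(𝒲, 𝒪_Z)`).  Universe-polymorphic Literature port of the Summits-side universe-`0`
file `…Theorems.HomologicalConductorSurfaceTerminationGenusTwoRegularLeray` (`GenusDescent.hasTrivialCechH1_comp_of_forall_stalk`,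
`GenusDescent.hasTrivialCechH1_comp_of_dimTwo`); decl names differ on purpose.

* `IsResolution.hasTrivialCechH1_comp_of_forall_stalk` — (L4): for a resolution `ρ : Z → X` with `X` regular
  integral and proper over `Spec T`, pointwise vanishing on every `Z ×_X Spec 𝒪_{X,x}` and `Ȟ¹(X, 𝒪) = 0` give
  `Ȟ¹(Z, 𝒪) = 0` on EVERY finite affine cover (finite affine refinement, affine mixed intersections
  `SeparatedAffinePreimage.isAffineOpen_inf_preimage`, (L3), cover independence `length_cechH1_eq_of_isAffineOpen`);
* `hasTrivialCechH1_comp_of_isBirational_of_forall_stalk` — (L) = the skeleton's `stub_leray`: the hypothesis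
  is asked only at the points of dimension `2` ((L1) supplies the others).

No definitions, no named facts; (1.2) `Lipman1969_1_2` stays PRINT; nothing about it is proved here; no summit
statement is proved.

## References
* A. Grothendieck, EGA III₁ (1961), Prop. (1.4.15). [EGAIII1]
* U. Görtz, T. Wedhorn, *Algebraic Geometry II* (2023), Cor. 21.82. [GortzWedhorn2023]
* R. Hartshorne, *Algebraic Geometry* (1977), III Thm. 4.5. [Hartshorne1977]
* The Stacks Project, Tag 0AY8. [StacksProject]
-/

noncomputable section

open CategoryTheory CategoryTheory.Limits AlgebraicGeometry TopologicalSpace IsLocalRing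
open Literature.AlgebraicGeometry.Morphisms Literature.AlgebraicGeometry.Morphisms.CechLocalization

universe u

namespace Literature.AlgebraicGeometry.Resolution

/-! ## (L4) the gluing: `Ȟ¹(X, 𝒪) = 0 ⇒ Ȟ¹(Z, 𝒪) = 0` for every finite affine cover of `Z` -/

section Glue

/-- Lattice bookkeeping: `a ⊓ c ⊓ (b ⊓ c) = a ⊓ b ⊓ c`. [folklore] -/
private theorem inf_inf_inf_inf_eq' {L : Type*} [Lattice L] (a b c : L) :
    a ⊓ c ⊓ (b ⊓ c) = a ⊓ b ⊓ c := by
  apply le_antisymm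
  · exact le_inf (le_inf (inf_le_left.trans inf_le_left) (inf_le_right.trans inf_le_left))
      (inf_le_left.trans inf_le_right)
  · exact le_inf (le_inf (inf_le_left.trans inf_le_left) inf_le_right)
      (le_inf (inf_le_left.trans inf_le_right) inf_le_right)

/-- Lattice bookkeeping: `a ⊓ d ⊓ (b ⊓ d) ⊓ (c ⊓ d) = a ⊓ b ⊓ c ⊓ d`. [folklore] -/
private theorem inf_inf_inf_inf_inf_eq' {L : Type*} [Lattice L] (a b c d : L) :
    a ⊓ d ⊓ (b ⊓ d) ⊓ (c ⊓ d) = a ⊓ b ⊓ c ⊓ d := by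
  rw [inf_inf_inf_inf_eq', inf_assoc (a ⊓ b) d, inf_comm d (c ⊓ d), inf_assoc c d d, inf_idem,
    ← inf_assoc]

/-- **Finite affine refinement of an open cover of a quasi-compact scheme** (indexed in the scheme's
universe): affine opens form a basis, and finitely many of those inside members of the cover still cover.
[folklore] -/
private theorem exists_finite_isAffineOpen_refinement (X : Scheme.{u}) [CompactSpace X] {α : Type*}
    (O : α → X.Opens) (hO : ⨆ a, O a = ⊤) :
    ∃ (ι : Type u) (_ : Finite ι) (U : ι → X.Opens) (r : ι → α),
      (∀ i, IsAffineOpen (U i)) ∧ (∀ i, U i ≤ O (r i)) ∧ ⨆ i, U i = ⊤ := by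
  classical
  have hpt : ∀ x : X, ∃ p : X.Opens × α, IsAffineOpen p.1 ∧ x ∈ p.1 ∧ p.1 ≤ O p.2 := by
    intro x
    have hx : x ∈ ⨆ a, O a := by rw [hO]; trivial
    obtain ⟨a, ha⟩ := Opens.mem_iSup.mp hx
    obtain ⟨U, hU, hxU, hUO⟩ := Opens.isBasis_iff_nbhd.mp X.isBasis_affineOpens ha
    exact ⟨(U, a), hU, hxU, hUO⟩
  choose p hp using hpt
  obtain ⟨t, ht⟩ := IsCompact.elim_finite_subcover CompactSpace.isCompact_univ
    (fun x : X => ((p x).1 : Set X)) (fun x => (p x).1.2)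
    (fun x _ => Set.mem_iUnion.mpr ⟨x, (hp x).2.1⟩)
  refine ⟨↥t, inferInstance, fun i => (p i.1).1, fun i => (p i.1).2, fun i => (hp i.1).1,
    fun i => (hp i.1).2.2, ?_⟩
  refine top_le_iff.mp fun x _ => ?_
  have hx := ht (Set.mem_univ x)
  simp only [Set.mem_iUnion] at hx
  obtain ⟨y, hy, hxy⟩ := hx
  exact Opens.mem_iSup.mpr ⟨⟨y, hy⟩, hxy⟩

/-- **(L4) Leray in degree one, global form with a pointwise hypothesis**: for a resolution `ρ : Z → X`
(proper birational, `Z` regular) with `X` regular integral, `πX : X → Spec T` proper, if `Ȟ¹ = 0` on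
`Z ×_X Spec 𝒪_{X,x} → Spec 𝒪_{X,x}` at every point `x` and `Ȟ¹(X, 𝒪_X) = 0` on every finite affine open cover
(`HasTrivialCechH1 πX`), then `Ȟ¹(Z, 𝒪_Z) = 0` on every finite affine open cover (`HasTrivialCechH1 (ρ ≫ πX)`):
a finite affine cover `𝒰` of `X` and a finite affine cover `𝒲` of `Z` refining `ρ⁻¹𝒰` (mixed intersections
affine since `Z` is separated over the affine base, `SeparatedAffinePreimage.isAffineOpen_inf_preimage`) give
`Ȟ¹(𝒰, 𝒪_X) = 0 ↠ Ȟ¹(𝒲, 𝒪_Z)` by (L3), and `Ȟ¹` of the GIVEN cover has the same length as `Ȟ¹(𝒲, 𝒪_Z)`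
(`length_cechH1_eq_of_isAffineOpen`). [cite: GortzWedhorn2023, Cor. 21.82 (p. 265)]
[cite: Hartshorne1977, III Thm. 4.5 (p. 222)] -/
theorem IsResolution.hasTrivialCechH1_comp_of_forall_stalk {T : Type u} [CommRing T] {X Z : Scheme.{u}}
    [IsIntegral X] [IsNoetherian X] [IsNoetherian Z] (πX : X ⟶ Spec (.of T)) [IsProper πX]
    {ρ : Z ⟶ X} (hρ : IsResolution ρ) (hX : Scheme.IsRegular X)
    (hpt : ∀ x : X, HasTrivialCechH1 (pullback.snd ρ (X.fromSpecStalk x)))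
    (h0 : HasTrivialCechH1 πX) : HasTrivialCechH1 (ρ ≫ πX) := by
  classical
  haveI := hρ.isProper
  haveI : IsIntegral Z := hρ.isIntegral_source
  haveI : Z.IsSeparated := ⟨by rw [← terminal.comp_from (ρ ≫ πX)]; infer_instance⟩
  intro κ _ V hVaff hVcov
  -- a finite affine cover `𝒰` of `X` and a finite affine cover `𝒲` of `Z` refining `ρ⁻¹𝒰`
  obtain ⟨ι', _, UX, -, hUXaff, -, hUXcov⟩ :=
    exists_finite_isAffineOpen_refinement X (fun _ : Unit => (⊤ : X.Opens)) (by simp)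
  obtain ⟨κ', _, WZ, rZ, hWZaff, hWZr, hWZcov⟩ := exists_finite_isAffineOpen_refinement Z
    (fun i => ρ ⁻¹ᵁ UX i) (by rw [← Scheme.Hom.preimage_iSup, hUXcov]; exact Opens.map_top _)
  -- affine intersections (`Z` separated over the affine base)
  have hUW : ∀ i j, IsAffineOpen (ρ ⁻¹ᵁ UX i ⊓ WZ j) := fun i j => by
    rw [inf_comm]
    exact SeparatedAffinePreimage.isAffineOpen_inf_preimage ρ πX (hWZaff j) (hUXaff i)
  have hUW2 : ∀ i j j', IsAffineOpen (ρ ⁻¹ᵁ UX i ⊓ WZ j ⊓ (ρ ⁻¹ᵁ UX i ⊓ WZ j')) := by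
    intro i j j'
    rw [inf_comm (ρ ⁻¹ᵁ UX i) (WZ j), inf_comm (ρ ⁻¹ᵁ UX i) (WZ j'), inf_inf_inf_inf_eq']
    exact SeparatedAffinePreimage.isAffineOpen_inf_preimage ρ πX ((hWZaff j).inf (hWZaff j'))
      (hUXaff i)
  have hUW3 : ∀ i j j' j'', IsAffineOpen
      (ρ ⁻¹ᵁ UX i ⊓ WZ j ⊓ (ρ ⁻¹ᵁ UX i ⊓ WZ j') ⊓ (ρ ⁻¹ᵁ UX i ⊓ WZ j'')) := by
    intro i j j' j''
    rw [inf_comm (ρ ⁻¹ᵁ UX i) (WZ j), inf_comm (ρ ⁻¹ᵁ UX i) (WZ j'), inf_comm (ρ ⁻¹ᵁ UX i) (WZ j''),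
      inf_inf_inf_inf_inf_eq']
    exact SeparatedAffinePreimage.isAffineOpen_inf_preimage ρ πX
      (((hWZaff j).inf (hWZaff j')).inf (hWZaff j'')) (hUXaff i)
  -- `Ȟ¹(𝒰, 𝒪_X) = 0 ↠ Ȟ¹(𝒲, 𝒪_Z)`
  have hsurj := cechRefineH1_comp_cechComapH1_surjective_of_forall_hasTrivialCechH1 ρ πX hρ.isBirational
    hX hpt UX hUXaff WZ hWZcov rZ hWZr hUW hUW2 hUW3
  haveI : Subsingleton (CechH1 πX UX) := h0 ι' UX hUXaff hUXcov
  have hW : Subsingleton (CechH1 (ρ ≫ πX) WZ) := hsurj.subsingleton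
  -- independence of the affine cover: `𝒲` versus the given `𝒱`
  have e := length_cechH1_eq_of_isAffineOpen (ρ ≫ πX) V WZ hVaff hWZaff hVcov hWZcov
  have h0' : Module.length T (CechH1 (ρ ≫ πX) WZ) = 0 := Module.length_eq_zero_iff.mpr hW
  rw [← e] at h0'
  exact Module.length_eq_zero_iff.mp h0'

/-- **(L) Leray + localisation with a pointwise hypothesis** (row F79-L of the F-79 «2-reg» cell at universe
`u`; the skeleton's `stub_leray`, binders byte-identical): for `ρ : X → Y₁` proper birational between regular
schemes over `Spec T` (`bl : Y₁ → Spec T` proper, `Y₁` integral Noetherian with local rings of dimension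
`≤ 2`), if `Ȟ¹` vanishes on the base change of `ρ` to `Spec 𝒪_{Y₁,y}` at every point `y` of dimension `2`
and `Ȟ¹(Y₁, 𝒪) = 0`, then `Ȟ¹(X, 𝒪) = 0` — from (L1) (points of dimension `≤ 1` need no hypothesis) and (L4).
[cite: EGAIII1, Prop. (1.4.15)] [cite: StacksProject, Tag 0AY8] -/
theorem hasTrivialCechH1_comp_of_isBirational_of_forall_stalk {T : Type u} [CommRing T]
    {X Y₁ : Scheme.{u}} [IsIntegral Y₁] [IsNoetherian Y₁]
    [IsNoetherian X] (bl : Y₁ ⟶ Spec (.of T)) [IsProper bl] (ρ : X ⟶ Y₁) [IsProper ρ]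
    (hρ : IsBirational ρ) (hX : Scheme.IsRegular X) (hY : Scheme.IsRegular Y₁)
    (hdimY : ∀ y : Y₁, ringKrullDim (Y₁.presheaf.stalk y) ≤ 2)
    (hpt : ∀ y : Y₁, ringKrullDim (Y₁.presheaf.stalk y) = 2 →
      HasTrivialCechH1 (pullback.snd ρ (Y₁.fromSpecStalk y)))
    (hY1 : HasTrivialCechH1 bl) : HasTrivialCechH1 (ρ ≫ bl) :=
  have hres : IsResolution ρ := ⟨inferInstance, hρ, hX⟩
  hres.hasTrivialCechH1_comp_of_forall_stalk bl hY
    (fun y => hres.hasTrivialCechH1_pullback_snd_fromSpecStalk y (hY y) (hdimY y) (hpt y)) hY1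

end Glue

end Literature.AlgebraicGeometry.Resolution

end
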